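import Literature.Topology.FourManifolds.BandCoreRebuild
import HarnessLib

/-!
# The rebuilt attaching circle along its lower arch: explicit formulas

Topic `Literature/Topology/FourManifolds`; fact seat `provefact-IsStrictHandleSlide.isSurgery`
(R. C. Kirby, *The Topology of 4-Manifolds*, LNM 1374 (1989), Ch. I §4; remaining content: the
named fact (S) `Literature.Topology.FourManifolds.FramedLink.IsStrictHandleSlide.slideModel`).
The reshaping of the rebuilt attaching circle `c.rebuild` (`BandCoreRebuild.lean`) near the
push-off works with the parameter `t ∈ [alo, tlo)` of its lower arch, where the knot is the band
image of the explicit planar arch `cLo t = (χ₁ t, v t)` (`BandCore.cLo_eq_planarArch`,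
`PlanarArchExplicit.lean`): `χ₁ = smoothStep (alo + ε) (tlo - ε)`,
`v = (1 - χ₂) fLo + χ₂ gLo`, `χ₂ = smoothStep (alo + 2ε) (tlo - 2ε)`, `ε = epsLo`. This file records
these formulas in the form consumed by the planar families (`PlanarConvexFamily.lean`). Proved
here (no definitions, no named facts):

* `BandCore.curve_rebuild_eq_pieceFun`, `BandCore.curve_rebuild_eq_band_cLo` — on the fundamental
  domain the curve of `rebuild` is the piece function, on `[alo, tlo)` the band image of `cLo`;
* `BandCore.cLo_apply`, `BandCore.cLo_apply_zero`, `BandCore.cLo_apply_one` — the coordinates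
  of the lower arch;
* `BandCore.cLo_fst_eq_zero_of_le`, `BandCore.cLo_fst_eq_one_of_ge`, `BandCore.cLo_snd_eq_fLo_of_le`,
  `BandCore.cLo_snd_eq_gLo_of_ge` — its plateaux.

## References

* R. C. Kirby, *The Topology of 4-Manifolds*, LNM 1374, Springer (1989), Ch. I §4. [Kirby1989]
-/

open scoped Manifold ContDiff Topology Real
open Function Set Metric

noncomputable section

namespace Literature.Topology.FourManifolds

namespace BandCore

variable {A B : Knot} {avoid : Set (Metric.sphere (0 : EuclideanSpace ℝ (Fin 4)) 1)} (c : BandCore A B avoid)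

/-- **On the fundamental domain the curve of the rebuilt knot is the piece function.** [folklore] -/
theorem curve_rebuild_eq_pieceFun (hAB : Disjoint (range ⇑A) (range ⇑B)) {s : ℝ} (hs : s ∈ Ico c.alo (c.alo + 1)) :
    Knot.curve (c.rebuild hAB) s = c.pieceFun s := by
  rw [Knot.curve_apply, c.coe_rebuild_circlePt hAB, rebuildCurve, c.red_eq_sub (n := 0) (by simpa using hs)]
  simp

/-- **On `[alo, tlo)` the rebuilt knot is the band image of the lower arch.** [folklore] -/
theorem curve_rebuild_eq_band_cLo (hAB : Disjoint (range ⇑A) (range ⇑B)) {s : ℝ} (hs : s ∈ Ico c.alo c.tlo) :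
    Knot.curve (c.rebuild hAB) s =
      ((c.band (c.cLo s) : Metric.sphere (0 : EuclideanSpace ℝ (Fin 4)) 1) : EuclideanSpace ℝ (Fin 4)) := by
  have hlt : c.tlo < c.alo + 1 := by
    have h := c.marks_lt
    linarith [h.2.2.2.1, h.2.2.2.2.1, h.2.2.2.2.2.1, h.2.2.2.2.2.2.1, h.2.2.2.2.2.2.2]
  rw [c.curve_rebuild_eq_pieceFun hAB ⟨hs.1, hs.2.trans hlt⟩, c.pieceFun_of_lt_tlo hs.2]

/-- **The lower arch in coordinates.** [folklore] -/
theorem cLo_apply (t : ℝ) : c.cLo t = pt2 (smoothStep (c.alo + c.epsLo) (c.tlo - c.epsLo) t)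
    ((1 - smoothStep (c.alo + 2 * c.epsLo) (c.tlo - 2 * c.epsLo) t) * c.fLo t +
      smoothStep (c.alo + 2 * c.epsLo) (c.tlo - 2 * c.epsLo) t * c.gLo t) := by
  rw [c.cLo_eq_planarArch]; rfl

/-- The first coordinate of the lower arch. [folklore] -/
theorem cLo_apply_zero (t : ℝ) : c.cLo t 0 = smoothStep (c.alo + c.epsLo) (c.tlo - c.epsLo) t := by
  rw [c.cLo_apply]; rfl

/-- The second coordinate (height) of the lower arch. [folklore] -/
theorem cLo_apply_one (t : ℝ) : c.cLo t 1 =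
    (1 - smoothStep (c.alo + 2 * c.epsLo) (c.tlo - 2 * c.epsLo) t) * c.fLo t +
      smoothStep (c.alo + 2 * c.epsLo) (c.tlo - 2 * c.epsLo) t * c.gLo t := by
  rw [c.cLo_apply]; rfl

/-- The basic inequalities of the lower-arch parameters: `0 < ε`, `alo + 2ε < tlo - 2ε`. [folklore] -/
theorem epsLo_pos' : 0 < c.epsLo := c.cLo_hyp.1

/-- `alo + 2 ε < tlo - 2 ε`. [folklore] -/
theorem alo_add_lt_tlo_sub : c.alo + 2 * c.epsLo < c.tlo - 2 * c.epsLo := c.cLo_hyp.2.1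

/-- Before `alo + ε` the lower arch is on the left edge: first coordinate `0`. [folklore] -/
theorem cLo_fst_eq_zero_of_le {t : ℝ} (ht : t ≤ c.alo + c.epsLo) : c.cLo t 0 = 0 := by
  rw [c.cLo_apply_zero]
  have h := c.alo_add_lt_tlo_sub
  have hε := c.epsLo_pos'
  exact smoothStep_of_le (by linarith) ht

/-- After `tlo - ε` the lower arch is on the right edge: first coordinate `1`. [folklore] -/
theorem cLo_fst_eq_one_of_ge {t : ℝ} (ht : c.tlo - c.epsLo ≤ t) : c.cLo t 0 = 1 := by
  rw [c.cLo_apply_zero]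
  have h := c.alo_add_lt_tlo_sub
  have hε := c.epsLo_pos'
  exact smoothStep_of_ge (by linarith) ht

/-- Before `alo + 2ε` the height of the lower arch is `fLo`. [folklore] -/
theorem cLo_snd_eq_fLo_of_le {t : ℝ} (ht : t ≤ c.alo + 2 * c.epsLo) : c.cLo t 1 = c.fLo t := by
  rw [c.cLo_apply_one, smoothStep_of_le c.alo_add_lt_tlo_sub ht]; ring

/-- After `tlo - 2ε` the height of the lower arch is `gLo`. [folklore] -/
theorem cLo_snd_eq_gLo_of_ge {t : ℝ} (ht : c.tlo - 2 * c.epsLo ≤ t) : c.cLo t 1 = c.gLo t := by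
  rw [c.cLo_apply_one, smoothStep_of_ge c.alo_add_lt_tlo_sub ht]; ring

/-- The first coordinate of the lower arch lies in `[0, 1]`. [folklore] -/
theorem cLo_fst_mem_Icc (t : ℝ) : c.cLo t 0 ∈ Icc (0 : ℝ) 1 := by
  rw [c.cLo_apply_zero]; exact smoothStep_mem_Icc _ _ _

/-- The first coordinate of the lower arch is non-decreasing. [folklore] -/
theorem deriv_cLo_fst_nonneg (t : ℝ) : 0 ≤ deriv (fun t ↦ c.cLo t 0) t := by
  have h := c.alo_add_lt_tlo_sub
  have hε := c.epsLo_pos'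
  rw [show (fun t ↦ c.cLo t 0) = smoothStep (c.alo + c.epsLo) (c.tlo - c.epsLo) from funext fun t ↦ c.cLo_apply_zero t]
  exact deriv_smoothStep_nonneg (by linarith) t

/-- The first coordinate of the lower arch is strictly increasing across `(alo + ε, tlo - ε)`.
[folklore] -/
theorem deriv_cLo_fst_pos {t : ℝ} (ht : t ∈ Ioo (c.alo + c.epsLo) (c.tlo - c.epsLo)) :
    0 < deriv (fun t ↦ c.cLo t 0) t := by
  have h := c.alo_add_lt_tlo_sub
  have hε := c.epsLo_pos'
  rw [show (fun t ↦ c.cLo t 0) = smoothStep (c.alo + c.epsLo) (c.tlo - c.epsLo) from funext fun t ↦ c.cLo_apply_zero t]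
  exact deriv_smoothStep_pos (by linarith) ht

end BandCore

end Literature.Topology.FourManifolds
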